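import Literature.NumberTheory.Sieve.LargestPrimeFactorCubicRegionBridge
import HarnessLib

/-!
# Heath-Brown 2001 (PLMS), §8 / (2.6): the cube side `m = ⌊X^{(1+δ)/3}⌋`, the relative error
# `η = 6000 m/N₁^{1/3} ≍ X^{−δ/6}`, and the smallness conditions, eventually in `X`

Topic `Literature/NumberTheory/Sieve`; a PROVED bookkeeping layer (two definitions with bodies, no named
facts) under the named fact `Irving2015_largestPrimeFactor_cubic` (`LargestPrimeFactorCubic.lean`): the
parameter choices for the cube decomposition of `regionGens` and the verification, for all large `X`, of
the hypotheses `C2`, `C3`, `hK`, `η ≤ 1/2`, "all `p ∈ 𝒦` odd" of `…S0Main.S0sumG_regionGens_ge`.  Source: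
D. R. Heath-Brown, *The largest prime factor of `X³ + 2`*, Proc. London Math. Soc. (3) 82 (2001) 554–596,
(2.6) `M = X^{(1+δ)/3}`, `N = X^{(1+2δ)/3}` and §8 p. 30 ((8.4): relative error `M N^{−1/3} ≤ X^{−δ/6}`).

* `mside X = ⌊X^{(1+δ)/3}⌋₊`, `etaX X = 6000 · mside X / (X^{1+3δ/2})^{1/3}`;
* `eventually_params` — eventually: `0 < mside`, `0 < etaX ≤ 1/2`, `C2` (equality), `C3`, `hK`, `𝒦` odd,
  and `etaX X ≤ 6000 X^{−δ/6}`; `tendsto_etaX` (`η → 0`), `mside_le`, `mside_ge` (`X^{(1+δ)/3}/2 ≤ m ≤ X^{(1+δ)/3}`).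

## References

* D. R. Heath-Brown, *The largest prime factor of `X³ + 2`*, Proc. London Math. Soc. (3) 82 (2001)
  554–596, (2.6) p. 6, §8 p. 30. [`HeathBrown2001LargestPrimeFactorCubic`]

## Mathlib / tree search

Tree: `hbδ`, `hbδ_pos`, `Npar`, `kPrimes`, `mem_kPrimes`, `gridK` (`…Setup`, `…RegionBridge`).
Mathlib: `tendsto_rpow_atTop`, `tendsto_rpow_neg_atTop`, `Filter.Tendsto.eventually_le_const`,
`Nat.floor_le`, `Nat.lt_floor_add_one`, `Real.rpow_natCast`, `Real.rpow_mul`, `Nat.Prime.odd_of_ne_two`.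
-/

noncomputable section

open Finset Real Filter Topology

namespace Literature.NumberTheory.Sieve.HeathBrown2001

open LargestPrimeFactorCubic

/-- The cube side `m = ⌊X^{(1+δ)/3}⌋` ((2.6): `M = X^{(1+δ)/3}`). [cite: HeathBrown2001LargestPrimeFactorCubic, (2.6)] -/
def mside (X : ℕ) : ℕ := ⌊(X : ℝ) ^ ((1 + hbδ) / 3)⌋₊

/-- The relative error parameter `η = 6000 m / N₁^{1/3}` (`N₁ = X^{1+3δ/2}`; `η ≍ X^{−δ/6}`).
[cite: HeathBrown2001LargestPrimeFactorCubic, §8 (8.4)] -/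
def etaX (X : ℕ) : ℝ := 6000 * (mside X : ℝ) / ((X : ℝ) ^ (1 + 3 * hbδ / 2)) ^ ((1 : ℝ) / 3)

/-- `m ≤ X^{(1+δ)/3}`. [folklore] -/
theorem mside_le (X : ℕ) : (mside X : ℝ) ≤ (X : ℝ) ^ ((1 + hbδ) / 3) := Nat.floor_le (by positivity)

/-- `X^{(1+δ)/3} − 1 < m`, hence `X^{(1+δ)/3}/2 ≤ m` once `X^{(1+δ)/3} ≥ 2`. [folklore] -/
theorem mside_ge {X : ℕ} (hX : (2 : ℝ) ≤ (X : ℝ) ^ ((1 + hbδ) / 3)) : (X : ℝ) ^ ((1 + hbδ) / 3) / 2 ≤ (mside X : ℝ) := by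
  have := Nat.lt_floor_add_one ((X : ℝ) ^ ((1 + hbδ) / 3))
  rw [mside]; linarith

/-- `(X^{1+3δ/2})^{1/3} = X^{(1+3δ/2)/3}` and `(X^{1+2δ})^{1/3} = Npar X`. [folklore] -/
theorem cbrt_N₁ (X : ℕ) : ((X : ℝ) ^ (1 + 3 * hbδ / 2)) ^ ((1 : ℝ) / 3) = (X : ℝ) ^ ((1 + 3 * hbδ / 2) / 3) := by
  rw [← Real.rpow_mul (Nat.cast_nonneg X)]; ring_nf

/-- Auxiliary fact `cbrt_N₂` for this file's estimates. [folklore] -/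
theorem cbrt_N₂ (X : ℕ) : ((X : ℝ) ^ (1 + 2 * hbδ)) ^ ((1 : ℝ) / 3) = Npar X := by
  rw [Npar, ← Real.rpow_mul (Nat.cast_nonneg X)]; ring_nf

/-- `η ≤ 6000 X^{−δ/6}` (`X ≥ 1`). [folklore] -/
theorem etaX_le {X : ℕ} (hX : 1 ≤ X) : etaX X ≤ 6000 * (X : ℝ) ^ (-(hbδ / 6)) := by
  have hX0 : (0 : ℝ) < X := by exact_mod_cast hX
  rw [etaX, cbrt_N₁, mul_div_assoc]
  refine mul_le_mul_of_nonneg_left ?_ (by norm_num)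
  rw [div_le_iff₀ (Real.rpow_pos_of_pos hX0 _), ← Real.rpow_add hX0]
  refine (mside_le X).trans (le_of_eq ?_)
  ring_nf

/-- `0 ≤ η`. [folklore] -/
theorem etaX_nonneg (X : ℕ) : 0 ≤ etaX X := by unfold etaX; positivity

/-- `η → 0`. [folklore] -/
theorem tendsto_etaX : Tendsto etaX atTop (𝓝 0) := by
  have hδ := hbδ_pos
  have h1 : Tendsto (fun X : ℕ => 6000 * (X : ℝ) ^ (-(hbδ / 6))) atTop (𝓝 0) := by
    have := ((tendsto_rpow_neg_atTop (by positivity : 0 < hbδ / 6)).comp tendsto_natCast_atTop_atTop).const_mul 6000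
    rw [mul_zero] at this
    refine this.congr fun X => ?_
    simp [Function.comp]
  refine squeeze_zero' (Eventually.of_forall etaX_nonneg) ?_ h1
  filter_upwards [eventually_ge_atTop 1] with X hX using etaX_le hX

/-- **The smallness conditions, eventually in `X`**: `0 < m`, `0 < η ≤ 1/2`, `C2` (`6000 m ≤ ηN₁^{1/3}`, indeed
equality), `C3` (`M₃ ≤ ηN₁/5000`), `hK` (`6N₂^{1/3} ≤ K m`, `K = gridK X`), and all `p ∈ 𝒦` are odd.
[cite: HeathBrown2001LargestPrimeFactorCubic, §8 p. 30, (2.6)] -/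
theorem eventually_params : ∀ᶠ X : ℕ in atTop,
    0 < mside X ∧ 0 < etaX X ∧ etaX X ≤ 1 / 2 ∧
    6000 * (mside X : ℝ) ≤ etaX X * ((X : ℝ) ^ (1 + 3 * hbδ / 2)) ^ ((1 : ℝ) / 3) ∧
    (X : ℝ) ^ (1 + hbδ) ≤ etaX X * (X : ℝ) ^ (1 + 3 * hbδ / 2) / 5000 ∧
    6 * ((X : ℝ) ^ (1 + 2 * hbδ)) ^ ((1 : ℝ) / 3) ≤ (gridK X) * (mside X : ℝ) ∧
    (∀ p ∈ kPrimes X, Odd p) := by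
  have hδ := hbδ_pos
  -- the thresholds
  have hm2 : ∀ᶠ X : ℕ in atTop, (2 : ℝ) ≤ (X : ℝ) ^ ((1 + hbδ) / 3) :=
    ((tendsto_rpow_atTop (by positivity)).comp tendsto_natCast_atTop_atTop).eventually_ge_atTop 2
  have hη12 : ∀ᶠ X : ℕ in atTop, etaX X ≤ 1 / 2 :=
    (tendsto_etaX).eventually_le_const (by norm_num)
  have hk2 : ∀ᶠ X : ℕ in atTop, (2 : ℝ) ≤ (X : ℝ) ^ (3 * hbδ) :=
    ((tendsto_rpow_atTop (by positivity)).comp tendsto_natCast_atTop_atTop).eventually_ge_atTop 2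
  -- `C3`: `X^{1+δ} ≤ 1.2 m X^{(2+3δ)/3}`; with `m ≥ X^{(1+δ)/3}/2` it suffices that `X^{1+δ} ≤ 0.6 X^{1 + 4δ/3}`
  have hC3 : ∀ᶠ X : ℕ in atTop, (1 : ℝ) ≤ (3 / 5 : ℝ) * (X : ℝ) ^ (hbδ / 3) := by
    have h := ((tendsto_rpow_atTop (by positivity : 0 < hbδ / 3)).comp tendsto_natCast_atTop_atTop).const_mul_atTop
      (by norm_num : (0 : ℝ) < 3 / 5)
    exact (h.eventually_ge_atTop 1).mono fun X hX => by simpa [Function.comp] using hX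
  filter_upwards [hm2, hη12, hk2, hC3, eventually_ge_atTop 1] with X hXm hη hXk hC3X hX1
  have hX0 : (0 : ℝ) < X := by exact_mod_cast hX1
  have hmpos : 0 < mside X := by
    have := mside_ge hXm
    have h1 : (1 : ℝ) ≤ mside X := by linarith
    exact_mod_cast h1
  have hmR : (0 : ℝ) < mside X := by exact_mod_cast hmpos
  have hηpos : 0 < etaX X := by unfold etaX; positivity
  have hC2 : 6000 * (mside X : ℝ) ≤ etaX X * ((X : ℝ) ^ (1 + 3 * hbδ / 2)) ^ ((1 : ℝ) / 3) := by
    rw [etaX, div_mul_cancel₀ _ (Real.rpow_pos_of_pos (by positivity) _).ne']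
  refine ⟨hmpos, hηpos, hη, hC2, ?_, ?_, ?_⟩
  · -- `C3`
    rw [etaX, cbrt_N₁]
    have e1 : 6000 * (mside X : ℝ) / (X : ℝ) ^ ((1 + 3 * hbδ / 2) / 3) * (X : ℝ) ^ (1 + 3 * hbδ / 2) / 5000 =
        (6 / 5 : ℝ) * (mside X : ℝ) * (X : ℝ) ^ ((2 + 3 * hbδ) / 3) := by
      rw [show (1 + 3 * hbδ / 2 : ℝ) = (1 + 3 * hbδ / 2) / 3 + (2 + 3 * hbδ) / 3 by ring, Real.rpow_add hX0]
      field_simp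
      ring
    rw [e1]
    have hmge := mside_ge hXm
    calc (X : ℝ) ^ (1 + hbδ) = 1 * ((X : ℝ) ^ ((1 + hbδ) / 3) * (X : ℝ) ^ ((2 + 3 * hbδ) / 3) / (X : ℝ) ^ (hbδ / 3)) := by
          rw [← Real.rpow_add hX0, ← Real.rpow_sub hX0]; ring_nf
      _ ≤ ((3 / 5 : ℝ) * (X : ℝ) ^ (hbδ / 3)) *
            ((X : ℝ) ^ ((1 + hbδ) / 3) * (X : ℝ) ^ ((2 + 3 * hbδ) / 3) / (X : ℝ) ^ (hbδ / 3)) :=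
          mul_le_mul_of_nonneg_right hC3X (by positivity)
      _ = (6 / 5 : ℝ) * ((X : ℝ) ^ ((1 + hbδ) / 3) / 2) * (X : ℝ) ^ ((2 + 3 * hbδ) / 3) := by
          have : (X : ℝ) ^ (hbδ / 3) ≠ 0 := (Real.rpow_pos_of_pos hX0 _).ne'
          field_simp; ring
      _ ≤ (6 / 5 : ℝ) * (mside X : ℝ) * (X : ℝ) ^ ((2 + 3 * hbδ) / 3) := by gcongr
  · -- `hK`: `gridK X ≥ 8 Npar X`, `m ≥ 1`
    rw [cbrt_N₂]
    have hK : 8 * Npar X ≤ (gridK X : ℝ) := by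
      rw [gridK]; push_cast
      have := Nat.le_ceil (Npar X); linarith
    have hN0 : 0 ≤ Npar X := Npar_nonneg X
    have h1 : (1 : ℝ) ≤ mside X := by exact_mod_cast hmpos
    nlinarith
  · -- `𝒦` odd
    intro p hp
    obtain ⟨hpP, hlo, -⟩ := mem_kPrimes hp
    refine hpP.odd_of_ne_two ?_
    rintro rfl
    have : (2 : ℝ) < 2 := lt_of_le_of_lt hXk (by exact_mod_cast hlo)
    exact lt_irrefl _ this

end Literature.NumberTheory.Sieve.HeathBrown2001
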